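import Summits.KontsevichZagierPeriods.KontsevichZagierPeriods.Theorems.SoloBlindLemniscateReps
import Literature.Analysis.SpecialFunctions.LemniscateConstant
import HarnessLib

/-!
# Euler's lemniscate relation inside the three rules, III: `[A]·[B] = [π/4]`

**Theorem (Euler 1782, inside Kontsevich–Zagier's rules).** For the two ℚ-rational subgraph
representations `A₂`, `B₂` of `a = ∫₀¹ dx/√(1-x⁴)` and `b = ∫₀¹ x²dx/√(1-x⁴)`
(`SoloBlindLemniscateReps`), the four-dimensional rational representation `A₂ × B₂` of `a·b` is
KZ-EQUIVALENT to the two-dimensional rational representation `[(0,1)², 1/(1+x²y²)]` of `π/4`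
(`kz_euler_lemniscate`); in the ring `Q = FormalRep ⧸ relations`, `[A₂]·[B₂] = α(1)`
(`lemniscate_euler`).

The proof is a finite chain of moves, each one of the three rules with algebraic data:
Newton–Leibniz in `y` (2×), the substitution `t = x⁴` (2×), and then, inside the Beta calculus of
`SoloBlindBeta` (every identity there is itself a chain of rules (1)–(3)):
`β(¼,½) = β(½,¼) = 3β(½,5/4) = 3β(5/4,½)` (symmetry, translation, symmetry),
`β(5/4,½)β(¾,½) = β(½,½)β(¾,1)` (Dirichlet's substitution), `β(½,½) = [π]`, `¾β(¾,1) = 1`.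
No transcendence input is used: this is an unconditional instance of the conjecture relating a
genus-one period product to a genus-zero period, the period-calculus form of the Legendre relation
for the lemniscatic curve `y² = 1 - x⁴`.

Consequences: `a·b = π/4` as real numbers (`lemnA2_value_mul_lemnB2_value`, Euler), and the closed
forms `a = Γ(¼)²/(4√(2π))`, `b = π√(2π)/Γ(¼)²… = π/(4a)`.

References: L. Euler, E605 (1786) §§; G. Andrews, R. Askey, R. Roy, *Special Functions* (1999),
§1.1; M. Kontsevich, D. Zagier, *Periods* (2001), §1.2 Question 1.
-/

noncomputable section

namespace Summit.KontsevichZagierPeriods.KontsevichZagierPeriods.Theorems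

open Set MeasureTheory
open Literature.NumberTheory.Transcendental
open Literature.NumberTheory.Transcendental.KZ

namespace SoloBlind

/-- **Euler's lemniscate relation in `Q`: `[A₂]·[B₂] = α(1)`** (`α(1) = [(0,1), 1/(1+x²)]`,
value `π/4`). -/
theorem lemniscate_euler : mkQ (of lemnA2) * mkQ (of lemnB2) = alpha 1 := by
  have hA := mkQ_lemnA2
  have hB := mkQ_lemnB2
  have hS1 : betaQ (1 / 4) (1 / 2) = betaQ (1 / 2) (1 / 4) :=
    betaQ_symm (by norm_num) (by norm_num)
  have hT : (((3:ℚ) / 4 : ℚ) : K₀) • betaQ (1 / 2) (5 / 4) =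
      (((1:ℚ) / 4 : ℚ) : K₀) • betaQ (1 / 2) (1 / 4) := by
    have h := betaQ_transl (a := 1 / 2) (b := 1 / 4) (by norm_num) (by norm_num)
    rw [show (1 / 2 : ℚ) + 1 / 4 = 3 / 4 by norm_num,
      show (1 / 4 : ℚ) + 1 = 5 / 4 by norm_num] at h
    exact h
  have hS2 : betaQ (1 / 2) (5 / 4) = betaQ (5 / 4) (1 / 2) :=
    betaQ_symm (by norm_num) (by norm_num)
  have hD : betaQ (5 / 4) (1 / 2) * betaQ (3 / 4) (1 / 2) =
      betaQ (1 / 2) (1 / 2) * betaQ (3 / 4) 1 := by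
    have h := betaQ_dirichlet (a := 3 / 4) (b := 1 / 2) (c := 1 / 2) (by norm_num) (by norm_num)
      (by norm_num)
    rw [show (3 / 4 : ℚ) + 1 / 2 = 5 / 4 by norm_num,
      show (1 / 2 : ℚ) + 1 / 2 = 1 by norm_num] at h
    exact h
  have hF : (((3:ℚ) / 4 : ℚ) : K₀) • betaQ (3 / 4) 1 = 1 := betaQ_first (by norm_num)
  have hH : betaQ (1 / 2) (1 / 2) = (4 : K₀) • alpha 1 := betaQ_half_half
  have hp : algebraMap K₀ Q (((1:ℚ) / 4 : ℚ) : K₀) * 4 = 1 := by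
    rw [← map_ofNat (algebraMap K₀ Q) 4, ← map_mul,
      show (((1:ℚ) / 4 : ℚ) : K₀) * 4 = 1 by push_cast; norm_num, map_one]
  rw [Algebra.smul_def] at hA hB hF hH
  rw [Algebra.smul_def, Algebra.smul_def] at hT
  rw [map_ofNat] at hH
  set p := algebraMap K₀ Q (((1:ℚ) / 4 : ℚ) : K₀)
  set q := algebraMap K₀ Q (((3:ℚ) / 4 : ℚ) : K₀)
  linear_combination mkQ (of lemnB2) * hA + p * betaQ (1 / 4) (1 / 2) * hB +
    p ^ 2 * betaQ (3 / 4) (1 / 2) * hS1 - p * betaQ (3 / 4) (1 / 2) * hT +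
    p * q * betaQ (3 / 4) (1 / 2) * hS2 + p * q * hD + p * betaQ (1 / 2) (1 / 2) * hF + p * hH +
    alpha 1 * hp

/-- **Euler's relation inside the rules.** The rational four-dimensional representation
`A₂ × B₂` of `a·b` and the rational one-dimensional representation `[(0,1), 1/(1+x²)]` of `π/4`
are equivalent under finitely many instances of Kontsevich–Zagier's rules (1)–(3). -/
theorem kz_euler_lemniscate :
    Equivalent (lemnA2.prod lemnB2) (atanCell 1 1 isAlgebraic_one isAlgebraic_one) := by
  rw [Equivalent, ← mkQ_eq_mkQ_iff, ← of_mul_of, mkQ_mul, lemniscate_euler,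
    alpha_eq isAlgebraic_one]

/-- **Euler 1782: `a · b = π/4`.** -/
theorem lemnA2_value_mul_lemnB2_value : lemnA2.value * lemnB2.value = Real.pi / 4 := by
  have h := congrArg evalQ lemniscate_euler
  rwa [map_mul, evalQ_mkQ, evalQ_mkQ, eval_of, eval_of, evalQ_alpha isAlgebraic_one zero_le_one,
    Real.arctan_one] at h

/-- `a = ¼ Γ(¼)Γ(½)/Γ(¾)`. -/
theorem lemnA2_value_eq_Gamma :
    lemnA2.value = 1 / 4 * (Real.Gamma (1 / 4) * Real.Gamma (1 / 2) / Real.Gamma (3 / 4)) := by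
  have h := congrArg evalQ mkQ_lemnA2
  rw [evalQ_mkQ, eval_of, evalQ_smul, evalQ_betaQ (by norm_num) (by norm_num),
    coe_ratCast_K₀] at h
  rw [h, show ((1 / 4 : ℚ) : ℝ) + (1 / 2 : ℚ) = 3 / 4 by norm_num]
  norm_num

/-- `a = Γ(¼)²/(4√(2π))` (the classical closed form; `2a = ϖ = 2.62205…`). -/
theorem lemnA2_value : lemnA2.value = Real.Gamma (1 / 4) ^ 2 / (4 * Real.sqrt (2 * Real.pi)) := by
  rw [lemnA2_value_eq_Gamma,
    Literature.Analysis.SpecialFunctions.Gamma_quarter_mul_Gamma_half_div_Gamma_three_quarters]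
  ring

/-- `a > 0`. -/
theorem lemnA2_value_pos : 0 < lemnA2.value := by
  rw [lemnA2_value]
  have h := Real.Gamma_pos_of_pos (by norm_num : (0:ℝ) < 1 / 4)
  exact div_pos (pow_pos h 2) (by positivity)

/-- `b = π/(4a)`. -/
theorem lemnB2_value : lemnB2.value = Real.pi / (4 * lemnA2.value) := by
  have h := lemnA2_value_mul_lemnB2_value
  have ha := lemnA2_value_pos
  field_simp
  linear_combination 4 * h

end SoloBlind

end Summit.KontsevichZagierPeriods.KontsevichZagierPeriods.Theorems
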